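import Summits.AtomisticToContinuum.FouriersLaw.Theorems.OddSectorIrreversibilityTapLeakBoundBlockConeMaximal
import Summits.AtomisticToContinuum.FouriersLaw.Theorems.OddSectorIrreversibilityTapLeakBoundBlockConeEnergy
import Summits.AtomisticToContinuum.FouriersLaw.Theorems.OddSectorIrreversibilityTapLeakBoundKickCone

/-!
# `TapLeakBound` (stmt-AtomisticToContinuum-15159), line `SketchIdeator2`, floor of `stub_kickCone`: site budgets and the good event

Helper file (`--supports stmt-AtomisticToContinuum-15159`) for crux
P = `Summit.AtomisticToContinuum.FouriersLaw.Theses.OddSectorIrreversibility.TapLeakBound`, registered stub `stub_kickCone`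
(C′ `ResampledKickCone`), FLOOR program (lead c3): the `N`-uniform resampled-kick cone of the CLOSED chain in the sublinear
window, by energy truncation. This file is the BOOKKEEPING between the landed deterministic block light cone and the
probabilistic tails (no new analysis, no new definitions — budgets are passed as functions with defining hypotheses):

* `siteEnergy_detFlow_le_budget` — for every site `m`, `0 ≤ τ ≤ s`: `h_m(Φ_τ x) ≤ B_m(x) := h_m(x) + ∫_{(0,s]}(|j_{m-1}| + |j_m|)(Φ_t x) dt`
  (the landed balances `siteEnergy_detFlow_le_interior` / `…_zero` + monotonicity in `τ`; `j_{-1} := 0`, written as a sum);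
* `stronglyMeasurable_budget`, `measurableSet_goodSet`, `goodSet_resample_iff` — measurability of the budgets, of the GOOD EVENT
  `G = {(x, p') : B_m(x) ≤ E ∧ B_m(x') ≤ E for all block sites m}` (`x' = (q, p[0 ↦ p'])` the kicked point), and its invariance
  under the resampling involution `S(x, p') = (x', p_0)`;
* `prod_compl_goodSet_le` — the union bound `(μ_T ⊗ N(0,T))(Gᶜ) ≤ 2 Σ_{block sites} μ_T{E < B_m}` (product structure for the
  `x`-conditions, `S`-preservation `stub_resamplePreserving` for the `x'`-conditions).

References: folklore. Nothing here closes the item.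
-/

noncomputable section

open MeasureTheory ProbabilityTheory Filter Topology Set Function
open scoped NNReal ENNReal

namespace Summit.AtomisticToContinuum.FouriersLaw.Theorems.OddSectorIrreversibility.TapLeak

open Literature.MathematicalPhysics.KineticTheory.HeatConduction
open Literature.MathematicalPhysics.KineticTheory
open Summit.AtomisticToContinuum.FouriersLaw.Theorems.OddSectorWitness
open Summit.AtomisticToContinuum.FouriersLaw.Theorems.ClosedConeSensitivity.Negative.ZeroFrictionDictionary
open Summit.AtomisticToContinuum.FouriersLaw.Theorems.OddSectorIrreversibility.Corrector

variable {N : ℕ}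

/-! ### The left current of a site, as a sum (no case split in statements) -/

/-- The left current `Σ_k [k+1 = m] j_k` of site `m` is `0` at the left end `m = 0`. [folklore] -/
theorem leftCurrent_eq_zero (P : OscillatorChain) {m : Fin N} (hm : m.val = 0) (z : PhaseSpace N) :
    (∑ k : Fin N, if k.val + 1 = m.val then P.bondCurrent N k z else 0) = 0 :=
  Finset.sum_eq_zero fun k _ => by rw [if_neg (by omega)]

/-- The left current `Σ_k [k+1 = m] j_k` of an interior site `m = i + 1` is `j_i`. [folklore] -/
theorem leftCurrent_eq_of_succ (P : OscillatorChain) {m i : Fin N} (him : m.val = i.val + 1) (z : PhaseSpace N) :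
    (∑ k : Fin N, if k.val + 1 = m.val then P.bondCurrent N k z else 0) = P.bondCurrent N i z := by
  rw [Finset.sum_eq_single i]
  · rw [if_pos (by omega)]
  · intro k _ hk
    rw [if_neg]
    intro h
    exact hk (Fin.ext (by omega))
  · intro h; exact absurd (Finset.mem_univ i) h

/-- The left current is continuous. [folklore] -/
theorem continuous_leftCurrent (ω₂ lam β γ : ℝ) (N : ℕ) (m : Fin N) :
    Continuous fun z : PhaseSpace N =>
      ∑ k : Fin N, if k.val + 1 = m.val then (pinnedChain ω₂ lam β γ).bondCurrent N k z else 0 := by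
  refine continuous_finsetSum _ fun k _ => ?_
  split_ifs
  · exact pinnedChain_continuous_bondCurrent ω₂ lam β γ N k
  · exact continuous_const

section Pinned

variable {ω₂ lam β : ℝ} (hω : 0 < ω₂) (hl : 0 ≤ lam) (hβ : 0 ≤ β)
include hω hl hβ

/-! ### The site budget controls the site energy along the flow -/

/-- **The budget controls the site energy along the closed flow.** For every site `m`, `0 ≤ τ ≤ s`:
`h_m(Φ_τ x) ≤ h_m(x) + ∫_{(0,s]} (|Σ_k[k+1=m] j_k| + |j_m|)(Φ_t x) dt`. [folklore] -/
theorem siteEnergy_detFlow_le_budget (m : Fin N) (X : PhaseSpace N → ℝ)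
    (hX : X = fun x => (∑ k : Fin N, (if k = m then (1 : ℝ) else 0) * (x.2 k ^ 2 / 2 + (pinnedChain ω₂ lam β 0).U (x.1 k))) +
      ∑ k : Fin N, ∑ l : Fin N,
        if l.val = k.val + 1 then ((if k = m then (1 : ℝ) else 0) + (if l = m then (1 : ℝ) else 0)) / 2 *
          (pinnedChain ω₂ lam β 0).V (x.1 l - x.1 k) else 0)
    (x : PhaseSpace N) {s τ : ℝ} (hτ : 0 ≤ τ) (hτs : τ ≤ s) :
    X (detFlow ω₂ lam β N τ x) ≤ X x + ∫ t in Ioc (0 : ℝ) s,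
      (|∑ k : Fin N, (if k.val + 1 = m.val then (pinnedChain ω₂ lam β 0).bondCurrent N k (detFlow ω₂ lam β N t x) else 0)| +
        |(pinnedChain ω₂ lam β 0).bondCurrent N m (detFlow ω₂ lam β N t x)|) := by
  set P0 := pinnedChain ω₂ lam β 0 with hP0
  set F : ℝ → ℝ := fun t =>
    |∑ k : Fin N, (if k.val + 1 = m.val then P0.bondCurrent N k (detFlow ω₂ lam β N t x) else 0)| +
      |P0.bondCurrent N m (detFlow ω₂ lam β N t x)| with hF
  have hΦc : Continuous fun t => detFlow ω₂ lam β N t x := Corrector.continuous_detFlow_time hω hl hβ N x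
  have hFc : Continuous F :=
    (((continuous_leftCurrent ω₂ lam β 0 N m).comp hΦc).abs).add
      (((pinnedChain_continuous_bondCurrent ω₂ lam β 0 N m).comp hΦc).abs)
  have hF0 : ∀ t, 0 ≤ F t := fun t => add_nonneg (abs_nonneg _) (abs_nonneg _)
  -- monotonicity of the window integral in `τ`
  have hmono : ∫ t in Ioc (0 : ℝ) τ, F t ≤ ∫ t in Ioc (0 : ℝ) s, F t :=
    setIntegral_mono_set hFc.integrableOn_Ioc (Eventually.of_forall hF0)
      (Eventually.of_forall (Ioc_subset_Ioc_right hτs))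
  have hint : ∫ t in (0 : ℝ)..τ, F t = ∫ t in Ioc (0 : ℝ) τ, F t := intervalIntegral.integral_of_le hτ
  by_cases hm : m.val = 0
  · -- left end: no inflow bond
    have h0 := siteEnergy_detFlow_le_zero (N := N) hl hβ m X hX hω hm x hτ
    have hle : ∫ t in (0 : ℝ)..τ, |P0.bondCurrent N m (detFlow ω₂ lam β N t x)| ≤ ∫ t in (0 : ℝ)..τ, F t := by
      refine intervalIntegral.integral_mono_on hτ
        (((pinnedChain_continuous_bondCurrent ω₂ lam β 0 N m).comp hΦc).abs.intervalIntegrable _ _)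
        (hFc.intervalIntegrable _ _) fun t _ => ?_
      simp only [hF]
      linarith [abs_nonneg (∑ k : Fin N, (if k.val + 1 = m.val then P0.bondCurrent N k (detFlow ω₂ lam β N t x) else 0))]
    linarith
  · -- interior: `m = i + 1`
    have hmpos : 0 < m.val := Nat.pos_of_ne_zero hm
    set i : Fin N := ⟨m.val - 1, by omega⟩ with hi
    have him : m.val = i.val + 1 := by simp [hi]; omega
    have h1 := siteEnergy_detFlow_le_interior (N := N) hl hβ m X hX hω him x hτ
    have hF' : ∀ t, F t = |P0.bondCurrent N i (detFlow ω₂ lam β N t x)| + |P0.bondCurrent N m (detFlow ω₂ lam β N t x)| :=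
      fun t => by simp only [hF, leftCurrent_eq_of_succ P0 him]
    have he : ∫ t in (0 : ℝ)..τ, (|P0.bondCurrent N i (detFlow ω₂ lam β N t x)| +
        |P0.bondCurrent N m (detFlow ω₂ lam β N t x)|) = ∫ t in (0 : ℝ)..τ, F t := by
      simp only [hF']
    linarith

/-! ### Measurability of the budget and of the good event -/

/-- The site budget `x ↦ h(x) + ∫_{(0,s]}(|f| + |g|)(Φ_t x) dt` is strongly measurable (`h, f, g` continuous). [folklore] -/
theorem stronglyMeasurable_budget {h f g : PhaseSpace N → ℝ} (hh : Continuous h) (hf : Continuous f)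
    (hg : Continuous g) (s : ℝ) :
    StronglyMeasurable fun x : PhaseSpace N =>
      h x + ∫ t in Ioc (0 : ℝ) s, (|f (detFlow ω₂ lam β N t x)| + |g (detFlow ω₂ lam β N t x)|) :=
  hh.stronglyMeasurable.add (budget_stronglyMeasurable hω hl hβ N hf hg s)

omit hω hl hβ in
/-- The kick map `(x, p') ↦ (q, p[b ↦ p'])` is continuous. [folklore] -/
theorem continuous_kick (b : Fin N) :
    Continuous fun z : PhaseSpace N × ℝ => ((z.1.1, Function.update z.1.2 b z.2) : PhaseSpace N) := by
  fun_prop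

omit hω hl hβ in
/-- The resampling involution exchanges the point and the kicked point: kicking `S z` returns `z.1`. [folklore] -/
theorem kick_resample (b : Fin N) (z : PhaseSpace N × ℝ) :
    (((z.1.1, Function.update z.1.2 b z.2) : PhaseSpace N).1,
      Function.update ((z.1.1, Function.update z.1.2 b z.2) : PhaseSpace N).2 b (z.1.2 b)) = z.1 := by
  rcases z with ⟨⟨q, p⟩, t⟩
  simp

omit hω hl hβ in
/-- **The good event is measurable.** For a finite family of strongly measurable budgets `B m` and a cap `E`,
`G = {z : ∀ m ∈ I, B m z.1 ≤ E ∧ B m (kick z) ≤ E}` is measurable. [folklore] -/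
theorem measurableSet_goodSet (b : Fin N) (I : Finset (Fin N)) (B : Fin N → PhaseSpace N → ℝ)
    (hB : ∀ m, StronglyMeasurable (B m)) (E : ℝ) :
    MeasurableSet {z : PhaseSpace N × ℝ | ∀ m ∈ I, B m z.1 ≤ E ∧
      B m ((z.1.1, Function.update z.1.2 b z.2) : PhaseSpace N) ≤ E} := by
  have hk : Measurable fun z : PhaseSpace N × ℝ => ((z.1.1, Function.update z.1.2 b z.2) : PhaseSpace N) :=
    (continuous_kick b).measurable
  have h1 : ∀ m, MeasurableSet {z : PhaseSpace N × ℝ | B m z.1 ≤ E} := fun m =>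
    measurableSet_le ((hB m).measurable.comp measurable_fst) measurable_const
  have h2 : ∀ m, MeasurableSet {z : PhaseSpace N × ℝ |
      B m ((z.1.1, Function.update z.1.2 b z.2) : PhaseSpace N) ≤ E} := fun m =>
    measurableSet_le ((hB m).measurable.comp hk) measurable_const
  have e : {z : PhaseSpace N × ℝ | ∀ m ∈ I, B m z.1 ≤ E ∧
      B m ((z.1.1, Function.update z.1.2 b z.2) : PhaseSpace N) ≤ E} =
      ⋂ m ∈ I, ({z : PhaseSpace N × ℝ | B m z.1 ≤ E} ∩
        {z | B m ((z.1.1, Function.update z.1.2 b z.2) : PhaseSpace N) ≤ E}) := by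
    ext z; simp
  rw [e]
  exact MeasurableSet.biInter I.countable_toSet fun m _ => (h1 m).inter (h2 m)

omit hω hl hβ in
/-- **The good event is invariant under the resampling involution** `S z = (kick z, p_b)`. [folklore] -/
theorem goodSet_resample_iff (b : Fin N) (I : Finset (Fin N)) (B : Fin N → PhaseSpace N → ℝ) (E : ℝ)
    (z : PhaseSpace N × ℝ) :
    z ∈ {z : PhaseSpace N × ℝ | ∀ m ∈ I, B m z.1 ≤ E ∧
      B m ((z.1.1, Function.update z.1.2 b z.2) : PhaseSpace N) ≤ E} ↔
    ((((z.1.1, Function.update z.1.2 b z.2) : PhaseSpace N), z.1.2 b) : PhaseSpace N × ℝ) ∈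
      {z : PhaseSpace N × ℝ | ∀ m ∈ I, B m z.1 ≤ E ∧
        B m ((z.1.1, Function.update z.1.2 b z.2) : PhaseSpace N) ≤ E} := by
  simp only [mem_setOf_eq]
  rw [kick_resample b z]
  exact ⟨fun h m hm => ⟨(h m hm).2, (h m hm).1⟩, fun h m hm => ⟨(h m hm).2, (h m hm).1⟩⟩

/-! ### The union bound for the bad event -/

/-- **Union bound for the bad event, uniformly in `N`.** With `μ = μ_T` (Gibbs weight), `ν = N(0,T)`, a finite set `I` of
sites, strongly measurable budgets `B m` and a cap `E`:
`(μ ⊗ ν)(Gᶜ) ≤ ofReal (2 Σ_{m ∈ I} μ.real{E < B m})` — the `x`-conditions by the product structure, the kicked conditions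
by the measure-preserving resampling involution (`stub_resamplePreserving`). [folklore] -/
theorem prod_compl_goodSet_le (γ : ℝ) {T : ℝ} (hT : 0 < T) (b : Fin N) (I : Finset (Fin N))
    (B : Fin N → PhaseSpace N → ℝ) (hB : ∀ m, StronglyMeasurable (B m)) (E : ℝ) :
    ((gibbsWeight ω₂ lam β γ N T).prod (gaussianReal 0 (Real.toNNReal T)))
        {z : PhaseSpace N × ℝ | ∀ m ∈ I, B m z.1 ≤ E ∧
          B m ((z.1.1, Function.update z.1.2 b z.2) : PhaseSpace N) ≤ E}ᶜ ≤
      ENNReal.ofReal (2 * ∑ m ∈ I, (gibbsWeight ω₂ lam β γ N T).real {x | E < B m x}) := by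
  set μ := gibbsWeight ω₂ lam β γ N T with hμ
  set ν : Measure ℝ := gaussianReal 0 (Real.toNNReal T) with hν
  haveI : IsFiniteMeasure μ := isFiniteMeasure_gibbsWeight hω hl hβ γ N hT
  haveI : IsProbabilityMeasure ν := by rw [hν]; infer_instance
  set S : PhaseSpace N × ℝ → PhaseSpace N × ℝ :=
    fun z => ((((z.1.1, Function.update z.1.2 b z.2)) : PhaseSpace N), z.1.2 b) with hS
  have hSp : MeasurePreserving S (μ.prod ν) (μ.prod ν) := stub_resamplePreserving ω₂ lam β γ hT b
  -- the two families of bad sets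
  set A : Fin N → Set (PhaseSpace N × ℝ) := fun m => {z | E < B m z.1} with hA
  set A' : Fin N → Set (PhaseSpace N × ℝ) := fun m =>
    {z | E < B m ((z.1.1, Function.update z.1.2 b z.2) : PhaseSpace N)} with hA'
  have hAm : ∀ m, MeasurableSet (A m) := fun m =>
    measurableSet_lt measurable_const ((hB m).measurable.comp measurable_fst)
  have hAS : ∀ m, A' m = S ⁻¹' (A m) := fun m => by
    ext z; simp [hA, hA', hS]
  -- their measures
  have hA_eq : ∀ m, (μ.prod ν) (A m) = μ {x | E < B m x} := fun m => by
    have e : A m = {x : PhaseSpace N | E < B m x} ×ˢ (univ : Set ℝ) := by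
      ext z; simp [hA]
    rw [e, Measure.prod_prod, measure_univ, mul_one]
  have hA'_eq : ∀ m, (μ.prod ν) (A' m) = μ {x | E < B m x} := fun m => by
    rw [hAS m, hSp.measure_preimage (hAm m).nullMeasurableSet, hA_eq m]
  -- inclusion of the bad event in the union
  have hsub : {z : PhaseSpace N × ℝ | ∀ m ∈ I, B m z.1 ≤ E ∧
      B m ((z.1.1, Function.update z.1.2 b z.2) : PhaseSpace N) ≤ E}ᶜ ⊆ ⋃ m ∈ I, (A m ∪ A' m) := by
    intro z hz
    simp only [mem_compl_iff, mem_setOf_eq, not_forall, not_and, exists_prop] at hz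
    obtain ⟨m, hmI, hm⟩ := hz
    simp only [mem_iUnion, mem_union, hA, hA', mem_setOf_eq, exists_prop]
    refine ⟨m, hmI, ?_⟩
    by_cases h1 : B m z.1 ≤ E
    · exact Or.inr (lt_of_not_ge (hm h1))
    · exact Or.inl (lt_of_not_ge h1)
  -- finite real sums
  have hfin : ∀ m, μ {x | E < B m x} ≠ ∞ := fun m => measure_ne_top μ _
  calc (μ.prod ν) {z : PhaseSpace N × ℝ | ∀ m ∈ I, B m z.1 ≤ E ∧
          B m ((z.1.1, Function.update z.1.2 b z.2) : PhaseSpace N) ≤ E}ᶜ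
      ≤ (μ.prod ν) (⋃ m ∈ I, (A m ∪ A' m)) := measure_mono hsub
    _ ≤ ∑ m ∈ I, (μ.prod ν) (A m ∪ A' m) := measure_biUnion_finset_le I _
    _ ≤ ∑ m ∈ I, ((μ.prod ν) (A m) + (μ.prod ν) (A' m)) :=
        Finset.sum_le_sum fun m _ => measure_union_le _ _
    _ = ∑ m ∈ I, ENNReal.ofReal (2 * μ.real {x | E < B m x}) := by
        refine Finset.sum_congr rfl fun m _ => ?_
        rw [hA_eq, hA'_eq, measureReal_def, ENNReal.ofReal_mul (by norm_num), ENNReal.ofReal_toReal (hfin m),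
          ENNReal.ofReal_ofNat, two_mul]
    _ = ENNReal.ofReal (2 * ∑ m ∈ I, μ.real {x | E < B m x}) := by
        rw [Finset.mul_sum, ENNReal.ofReal_sum_of_nonneg fun m _ => by positivity]

end Pinned

/-! ### Registered sub-goal of the line (closed form of `prod_compl_goodSet_le`) -/

/-- **Sub-goal `stub_floorBudgetUnion`** (registered on the crux item for this helper file; closed `∀`-form of
`prod_compl_goodSet_le`): the `N`-uniform union bound for the bad event of the floor program. [folklore] -/
theorem stub_floorBudgetUnion : ∀ (ω₂ lam β : ℝ), 0 < ω₂ → 0 ≤ lam → 0 ≤ β → ∀ (γ : ℝ) (N : ℕ) (T : ℝ), 0 < T → ∀ (b : Fin N) (I : Finset (Fin N)) (B : Fin N → PhaseSpace N → ℝ), (∀ m, MeasureTheory.StronglyMeasurable (B m)) → ∀ (E : ℝ), ((gibbsWeight ω₂ lam β γ N T).prod (ProbabilityTheory.gaussianReal 0 (Real.toNNReal T))) {z : PhaseSpace N × ℝ | ∀ m ∈ I, B m z.1 ≤ E ∧ B m ((z.1.1, Function.update z.1.2 b z.2) : PhaseSpace N) ≤ E}ᶜ ≤ ENNReal.ofReal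 (2 * ∑ m ∈ I, (gibbsWeight ω₂ lam β γ N T).real {x | E < B m x}) :=
  fun _ _ _ hω hl hβ γ _ _ hT b I B hB E => prod_compl_goodSet_le hω hl hβ γ hT b I B hB E

end Summit.AtomisticToContinuum.FouriersLaw.Theorems.OddSectorIrreversibility.TapLeak

end
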